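import Summits.QuantumFields.YangMills.Theses.ContractibleFibre
import Literature.MathematicalPhysics.QuantumFieldTheory.FreeTubeSlabCovariance
import Literature.MathematicalPhysics.QuantumFieldTheory.PlanarSliceKernelGaugeFixing
import Literature.Analysis.OperatorTheory.KernelPowerTraceGap

/-!
# Stub S1₀ — vacuum dominance with a rate for the PLANAR free tube (`M = 0`, two-dimensional lattice Yang–Mills)

Stub `stub_vdrPlanar` of line `trace-vdr` (skeleton `Cruxes/FibreAnchor/Lines/trace_vdr.lean`, lead reshape r3) for crux
`FibreAnchor` (stmt-QuantumFields-16243), route `ContractibleFibre` of `QuantumFields/YangMills`.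

Proof (exact solution of two-dimensional lattice gauge theory in transfer-matrix form, character free).  At fibre
width `M = 0` the free-face indicator kills every plaquette touching the directions `2, 3`, so the tube partition
function `Zt j` is the Wilson partition function of the `(j+1) × L` torus (the dangling links integrate to `1`).
Time slicing (`FreeTube.integral_exp_act_eq`) writes it as the cyclic integral of `j + 1` slice kernels `K`; at `M = 0`
the slice energy vanishes and gauge fixing the layer integral (`PlanarGauge.integral_exp_planarLayer_eq_kernel`) gives
`K(a, b) = k_{L-1}(hol a, hol b)` with the class-averaged kernels `k_m(A, B) = ∫ ω^{⋆(m+1)}(A⁻¹ x B x⁻¹) dx`,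
`ω = exp(β Re tr ρ)`, of `CentralFunctionTransferKernel`; the holonomy pushes product Haar measure to Haar measure
(`PlanarGauge.measurePreserving_holonomy`), so `Zt j = ∫ ∏_t k_{L-1}(h t, h (t+1)) dh`.  The kernels `k_m` are the
composition powers of the continuous, strictly positive, symmetric, positive-type kernel `k_0`, whence
(`KernelPowerTraceGap.exists_gap_hasSum_pow_integral_cyclic`: Hilbert–Schmidt, Lüscher positivity, Jentzsch's gap)
`Zt j = Σᵢ (νᵢ^L)^{j+1}` with `νᵢ ≤ θ < ν_{i₀}` off the simple top eigenvalue, and the two VDR bounds follow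
(`vdr_of_spectralGap`) with `lam = ν_{i₀}^L`, `C = Σνᵢ²/θ'²`, `(θ'/ν_{i₀})^{L_min} ≤ e^{−m₀}`.
References: A. A. Migdal, Sov. Phys. JETP 42 (1975) 413; B. K. Driver, Commun. Math. Phys. 123 (1989) 575, §7;
K. Osterwalder, E. Seiler, Ann. Phys. 110 (1978) 440, §2; Reed–Simon IV, Thms XIII.43–44.
-/

set_option autoImplicit false

noncomputable section

namespace Summit.QuantumFields.YangMills.Cruxes.FibreAnchor.TraceVDR

open scoped BigOperators
open MeasureTheory
open Summit.QuantumFields.YangMills.Theses.ContractibleFibre Literature.MathematicalPhysics.QuantumFieldTheory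
  Literature.MathematicalPhysics.QuantumLattice Literature.Analysis.OperatorTheory

/-- **Vacuum dominance with a rate, planar member `M = 0`** (stub S1₀ of line `trace-vdr`, crux `FibreAnchor`): for
every rate `m₀ > 0` and coupling `β ≥ 0` the Wilson partition functions of the width-0 free tubes (2-d lattice
Yang–Mills on the `(j+1) × L` torus) satisfy the two-sided trace domination VDR for `L ≥ L_min(β, m₀)`. See the
skeleton for the informal statement and the module docstring for the proof (slice kernel = `k_{L-1} ∘ hol`, Jentzsch gap
of the class-averaged one-plaquette kernel on `(G, Haar)`). [cite: OsterwalderSeiler1978, §2] -/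
theorem stub_vdrPlanar :
    ∀ (G : Type) [Group G] [TopologicalSpace G] [IsTopologicalGroup G] [CompactSpace G], Literature.MathematicalPhysics.QuantumFieldTheory.IsCompactSimpleLieGroup G → letI : MeasurableSpace G := borel G; haveI : BorelSpace G := ⟨rfl⟩; ∀ r : Literature.MathematicalPhysics.QuantumFieldTheory.LatticeRep G, let VDR := fun (M : ℕ) (β m₀ C : ℝ) (Lmin : ℕ) => ∀ (L : ℕ) [NeZero L], Lmin ≤ L → let Zt : ℕ → ℝ := fun j => let St := ZMod (j + 1) × ZMod L × Fin (M + 1) × Fin (M + 1); let Cfg := St × Fin 4 → G; let ν : MeasureTheory.Measure Cfg := MeasureTheory.Measure.pi fun _ => Literature.MathematicalPhysics.QuantumFieldTheory.haarProbability G; let sh : St → Fin 4 → St := fun x μ => ![(x.1 + 1, x.2.1, x.2.2.1, x.2.2.2), (x.1, x.2.1 + 1, x.2.2.1, x.2.2.2), (x.1, x.2.1, x.2.2.1 + 1, x.2.2.2), (x.1, x.2.1, x.2.2.1, x.2.2.2 + 1)] μ; let ins : St → Fin 4 → Fin 4 → ℝ := fun x μ κ => if ((μ = 2 ∨ κ =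 2) → (x.2.2.1 : ℕ) < M) ∧ ((μ = 3 ∨ κ = 3) → (x.2.2.2 : ℕ) < M) then 1 else 0; let pl : Cfg → St → Fin 4 → Fin 4 → G := fun U x μ κ => U (x, μ) * U (sh x μ, κ) * (U (sh x κ, μ))⁻¹ * (U (x, κ))⁻¹; let act : Cfg → ℝ := fun U => β * ∑ x : St, ∑ q : {q : Fin 4 × Fin 4 // q.1 < q.2}, ins x q.1.1 q.1.2 * (r.ρ (pl U x q.1.1 q.1.2)).trace.re; ∫ U, Real.exp (act U) ∂ν; ∃ lam : ℝ, 0 < lam ∧ (∀ j : ℕ, 1 ≤ j → lam ^ (j + 1) ≤ Zt j) ∧ ∀ j : ℕ, 1 ≤ j → j + 1 ≤ L → Zt j ≤ lam ^ (j + 1) * Real.exp (C * (L : ℝ) * Real.exp (-(m₀ * (j + 1)))); ∀ m₀ : ℝ, 0 < m₀ → ∀ β : ℝ, 0 ≤ β → ∃ C : ℝ, ∃ Lmin : ℕ, VDR 0 β m₀ C Lmin := by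
  intro G _ _ _ _ hG
  letI : MeasurableSpace G := borel G
  haveI : BorelSpace G := ⟨rfl⟩
  intro r VDR m₀ hm₀ β hβ
  haveI : SecondCountableTopology G :=
    (r.continuous.isClosedEmbedding r.injective).isEmbedding.secondCountableTopology
  -- the Wilson weight `ω = exp(β Re tr ρ)` and the class-averaged kernels `k_m(A, B) = ∫ ω^{⋆(m+1)}(A⁻¹ x B x⁻¹) dx`
  obtain ⟨ω, hωρ⟩ : ∃ ω : G → ℝ, ∀ g, ω g = Real.exp (β * (r.ρ g).trace.re) := ⟨_, fun _ => rfl⟩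
  obtain ⟨k, hk⟩ : ∃ k : ℕ → G → G → ℝ, ∀ m A B, k m A B =
      ∫ x, ((haarConv ω)^[m] ω) (A⁻¹ * x * B * x⁻¹) ∂haarProbability G := ⟨_, fun _ _ _ => rfl⟩
  have hωc : Continuous ω := by
    rw [show ω = fun g => Real.exp (β * (r.ρ g).trace.re) from funext hωρ]
    exact PlanarGauge.continuous_wilsonWeight r.ρ β r.continuous
  have hωz : ∀ g h, ω (h * g * h⁻¹) = ω g := fun g h => by
    rw [hωρ, hωρ, PlanarGauge.wilsonWeight_central]
  have hωi : ∀ g, ω g⁻¹ = ω g := fun g => by rw [hωρ, hωρ, PlanarGauge.wilsonWeight_symm r.ρ β r.mem_unitary]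
  have hω0 : ∀ g, 0 < ω g := fun g => by rw [hωρ]; exact Real.exp_pos _
  have hωpt : ∀ φ : G → ℝ, Measurable φ → (∀ x, |φ x| ≤ 1) →
      0 ≤ ∫ z, φ z.1 * ω (z.1 * z.2⁻¹) * φ z.2 ∂((haarProbability G).prod (haarProbability G)) := by
    intro φ hφ hφ1
    simp_rw [hωρ]
    exact PlanarGauge.posType_wilsonWeight r.ρ β r.continuous r.mem_unitary hβ φ hφ hφ1
  -- spectral data of `k_0` and the trace formulas for all `k_m` (Jentzsch's gap), then the VDR constants
  obtain ⟨ι, ν, i₀, θ, hν0, hνi₀, -, hθ, hgap, hS, hZ⟩ :=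
    exists_gap_hasSum_pow_integral_cyclic (μ := haarProbability G) k
      (fun m => CentralKernel.stronglyMeasurable_uncurry_kernel ω k hk hωc m)
      (fun m => CentralKernel.exists_norm_kernel_le ω k hk hωc m)
      (fun m x y => CentralKernel.kernel_symm ω k hk hωz hωi m x y)
      (fun x y => CentralKernel.kernel_pos ω k hk hωc hω0 0 x y)
      (CentralKernel.posType_kernel_zero ω k hk hωc hωz hωi hωpt)
      (fun m x z => CentralKernel.integral_kernel_zero_mul_kernel ω k hk hωc hωz m x z)
  obtain ⟨C, -, Lmin, -, hvdr⟩ := vdr_of_spectralGap hν0 hνi₀ hθ hgap hS m₀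
  refine ⟨C, Lmin, ?_⟩
  intro L _ hL
  obtain ⟨n, rfl⟩ : ∃ n, L = n + 1 := Nat.exists_eq_succ_of_ne_zero (NeZero.ne L)
  intro Zt
  -- objects of one time slice at `M = 0`: spatial shift, free-face indicator, slice and layer energies, the slice
  -- kernel `K` and the layer density `q` (variables with defining equations, as in the time-slicing package)
  obtain ⟨shS, hshS⟩ : ∃ shS : ZMod (n + 1) × Fin (0 + 1) × Fin (0 + 1) → Fin 3 → ZMod (n + 1) × Fin (0 + 1) × Fin (0 + 1),
      ∀ s i, shS s i = ![(s.1 + 1, s.2.1, s.2.2), (s.1, s.2.1 + 1, s.2.2), (s.1, s.2.1, s.2.2 + 1)] i :=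
    ⟨_, fun _ _ => rfl⟩
  obtain ⟨insS, hinsS⟩ : ∃ insS : ZMod (n + 1) × Fin (0 + 1) × Fin (0 + 1) → Fin 4 → Fin 4 → ℝ, ∀ s μ κ, insS s μ κ =
      if ((μ = 2 ∨ κ = 2) → (s.2.1 : ℕ) < 0) ∧ ((μ = 3 ∨ κ = 3) → (s.2.2 : ℕ) < 0) then 1 else 0 :=
    ⟨_, fun _ _ _ => rfl⟩
  obtain ⟨Ssp, hSsp⟩ : ∃ Ssp : ((ZMod (n + 1) × Fin (0 + 1) × Fin (0 + 1)) × Fin 3 → G) → ℝ, ∀ a, Ssp a =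
      β * ∑ s, ∑ i : Fin 3, ∑ j : Fin 3, if i < j then insS s i.succ j.succ *
        (r.ρ (a (s, i) * a (shS s i, j) * (a (shS s j, i))⁻¹ * (a (s, j))⁻¹)).trace.re else 0 := ⟨_, fun _ => rfl⟩
  obtain ⟨Stm, hStm⟩ : ∃ Stm : ((ZMod (n + 1) × Fin (0 + 1) × Fin (0 + 1)) × Fin 3 → G) →
      (ZMod (n + 1) × Fin (0 + 1) × Fin (0 + 1) → G) → ((ZMod (n + 1) × Fin (0 + 1) × Fin (0 + 1)) × Fin 3 → G) → ℝ,
      ∀ a e b, Stm a e b = β * ∑ s, ∑ j : Fin 3, insS s 0 j.succ *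
        (r.ρ (e s * b (s, j) * (e (shS s j))⁻¹ * (a (s, j))⁻¹)).trace.re := ⟨_, fun _ _ _ => rfl⟩
  obtain ⟨K, hK⟩ : ∃ K : ((ZMod (n + 1) × Fin (0 + 1) × Fin (0 + 1)) × Fin 3 → G) →
      ((ZMod (n + 1) × Fin (0 + 1) × Fin (0 + 1)) × Fin 3 → G) → ℝ, ∀ a b, K a b = Real.exp (Ssp a / 2) *
        (∫ e, Real.exp (Stm a e b) ∂(Measure.pi fun _ : ZMod (n + 1) × Fin (0 + 1) × Fin (0 + 1) =>
          Literature.MathematicalPhysics.QuantumFieldTheory.haarProbability G)) * Real.exp (Ssp b / 2) :=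
    ⟨_, fun _ _ => rfl⟩
  obtain ⟨q, hq⟩ : ∃ q : ((ZMod (n + 1) × Fin (0 + 1) × Fin (0 + 1)) × Fin 3 → G) →
      (ZMod (n + 1) × Fin (0 + 1) × Fin (0 + 1) → G) → ((ZMod (n + 1) × Fin (0 + 1) × Fin (0 + 1)) × Fin 3 → G) → ℝ,
      ∀ a e b, q a e b = Real.exp (Stm a e b) / ∫ e', Real.exp (Stm a e' b)
        ∂(Measure.pi fun _ : ZMod (n + 1) × Fin (0 + 1) × Fin (0 + 1) =>
          Literature.MathematicalPhysics.QuantumFieldTheory.haarProbability G) := ⟨_, fun _ _ _ => rfl⟩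
  -- (1) time slicing: `Zt j` is the cyclic integral of `j + 1` slice kernels, for every `j`
  have hZj : ∀ j : ℕ, Zt j = ∫ V : ZMod (j + 1) → (ZMod (n + 1) × Fin (0 + 1) × Fin (0 + 1)) × Fin 3 → G,
      ∏ t, K (V t) (V (t + 1)) ∂(Measure.pi fun _ => Measure.pi fun _ =>
        Literature.MathematicalPhysics.QuantumFieldTheory.haarProbability G) := fun j =>
    FreeTube.integral_exp_act_eq (T := j + 1) r.ρ β shS
      (fun x μ => ![(x.1 + 1, x.2.1, x.2.2.1, x.2.2.2), (x.1, x.2.1 + 1, x.2.2.1, x.2.2.2),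
        (x.1, x.2.1, x.2.2.1 + 1, x.2.2.2), (x.1, x.2.1, x.2.2.1, x.2.2.2 + 1)] μ)
      (fun _ _ => rfl) (fun t s i => by rw [hshS]; fin_cases i <;> rfl)
      (fun x μ κ => if ((μ = 2 ∨ κ = 2) → (x.2.2.1 : ℕ) < 0) ∧ ((μ = 3 ∨ κ = 3) → (x.2.2.2 : ℕ) < 0) then 1 else 0)
      insS (fun t s μ κ => by rw [hinsS]) _ (fun _ _ _ _ => rfl) _ (fun _ => rfl) _ (fun _ _ => rfl)
      Ssp hSsp Stm hStm K hK q hq r.continuous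
  -- (2) at `M = 0`: the slice energy vanishes, only the `(0, 1)` plaquettes enter the layer energy, and gauge fixing
  -- the layer integral gives the class-averaged kernel at the direction-`1` holonomies
  have hins_succ : ∀ (s : ZMod (n + 1) × Fin (0 + 1) × Fin (0 + 1)) (i j : Fin 3), i < j → insS s i.succ j.succ = 0 := by
    intro s i j hij
    rw [hinsS]
    fin_cases i <;> fin_cases j <;> simp at hij ⊢
  have hins_zero : ∀ (s : ZMod (n + 1) × Fin (0 + 1) × Fin (0 + 1)) (j : Fin 3),
      insS s 0 j.succ = if j = 0 then 1 else 0 := by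
    intro s j
    rw [hinsS]
    fin_cases j <;> simp
  have hSsp0 : ∀ a, Ssp a = 0 := fun a => by
    rw [hSsp]
    refine mul_eq_zero_of_right _ (Finset.sum_eq_zero fun s _ => Finset.sum_eq_zero fun i _ =>
      Finset.sum_eq_zero fun j _ => ?_)
    split_ifs with hij
    · rw [hins_succ s i j hij, zero_mul]
    · rfl
  have hStm' : ∀ a e b, Stm a e b = β * ∑ s,
      (r.ρ (e s * b (s, 0) * (e (s.1 + 1, s.2.1, s.2.2))⁻¹ * (a (s, 0))⁻¹)).trace.re := by
    intro a e b
    rw [hStm]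
    congr 1
    refine Finset.sum_congr rfl fun s _ => ?_
    simp only [hins_zero, ite_mul, one_mul, zero_mul, Finset.sum_ite_eq', Finset.mem_univ, if_true]
    rw [hshS]
    rfl
  have hKk : ∀ a b, K a b = k n (List.ofFn fun i : Fin (n + 1) => a ((i, 0, 0), 0)).prod
      (List.ofFn fun i : Fin (n + 1) => b ((i, 0, 0), 0)).prod := by
    intro a b
    rw [hK, hSsp0, hSsp0, zero_div, Real.exp_zero, one_mul, mul_one]
    simp_rw [hStm']
    exact PlanarGauge.integral_exp_planarLayer_eq_kernel r.ρ β ω hωρ k hk r.continuous a b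
  -- (3) the holonomy pushes product Haar measure forward to Haar measure: `Zt j` is the cyclic integral of `k_n`
  have hc : Function.Injective fun i : Fin (n + 1) =>
      ((((i : ZMod (n + 1)), (0 : Fin (0 + 1)), (0 : Fin (0 + 1))), (0 : Fin 3)) :
        (ZMod (n + 1) × Fin (0 + 1) × Fin (0 + 1)) × Fin 3) := by
    intro i j h
    exact congrArg (fun p : (ZMod (n + 1) × Fin (0 + 1) × Fin (0 + 1)) × Fin 3 => p.1.1) h
  have hmp : ∀ j : ℕ, MeasurePreserving
      (fun (V : ZMod (j + 1) → (ZMod (n + 1) × Fin (0 + 1) × Fin (0 + 1)) × Fin 3 → G) (t : ZMod (j + 1)) =>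
        (List.ofFn fun i : Fin (n + 1) => V t ((i, 0, 0), 0)).prod)
      (Measure.pi fun _ => Measure.pi fun _ => Literature.MathematicalPhysics.QuantumFieldTheory.haarProbability G)
      (Measure.pi fun _ => Literature.MathematicalPhysics.QuantumFieldTheory.haarProbability G) := fun j =>
    measurePreserving_pi
      (fun _ : ZMod (j + 1) => Measure.pi fun _ : (ZMod (n + 1) × Fin (0 + 1) × Fin (0 + 1)) × Fin 3 =>
        Literature.MathematicalPhysics.QuantumFieldTheory.haarProbability G)
      (fun _ : ZMod (j + 1) => Literature.MathematicalPhysics.QuantumFieldTheory.haarProbability G)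
      fun _ => PlanarGauge.measurePreserving_holonomy _ hc
  have hF : ∀ j : ℕ, Measurable fun h : ZMod (j + 1) → G => ∏ t, k n (h t) (h (t + 1)) := fun j =>
    Finset.measurable_prod _ fun t _ => (CentralKernel.continuous_uncurry_kernel ω k hk hωc n).measurable.comp
      (f := fun h : ZMod (j + 1) → G => (h t, h (t + 1))) ((measurable_pi_apply t).prodMk (measurable_pi_apply (t + 1)))
  have hZt : ∀ j : ℕ, Zt j = ∫ h : ZMod (j + 1) → G, ∏ t, k n (h t) (h (t + 1))
      ∂(Measure.pi fun _ => Literature.MathematicalPhysics.QuantumFieldTheory.haarProbability G) := by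
    intro j
    rw [hZj j]
    simp_rw [hKk]
    have h := integral_map (μ := Measure.pi fun _ : ZMod (j + 1) =>
      Measure.pi fun _ : (ZMod (n + 1) × Fin (0 + 1) × Fin (0 + 1)) × Fin 3 =>
        Literature.MathematicalPhysics.QuantumFieldTheory.haarProbability G)
      (hmp j).measurable.aemeasurable (hF j).aestronglyMeasurable
    rw [(hmp j).map_eq] at h
    exact h.symm
  -- (4) the trace formula `Zt (M+1) = Σᵢ (νᵢ^{n+1})^{M+2}` and the VDR bounds
  refine ⟨ν i₀ ^ (n + 1), pow_pos hνi₀ _, fun j hj => ?_, fun j hj _ => ?_⟩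
  · obtain ⟨M, rfl⟩ : ∃ M, j = M + 1 := Nat.exists_eq_succ_of_ne_zero (by omega)
    have hsum : HasSum (fun i => (ν i ^ (n + 1)) ^ (M + 2)) (Zt (M + 1)) := by rw [hZt]; exact hZ n M
    exact (hvdr (n + 1) hL M _ hsum).1
  · obtain ⟨M, rfl⟩ : ∃ M, j = M + 1 := Nat.exists_eq_succ_of_ne_zero (by omega)
    have hsum : HasSum (fun i => (ν i ^ (n + 1)) ^ (M + 2)) (Zt (M + 1)) := by rw [hZt]; exact hZ n M
    have hup := (hvdr (n + 1) hL M _ hsum).2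
    have ecast : -(m₀ * ((M : ℝ) + 2)) = -(m₀ * (((M + 1 : ℕ) : ℝ) + 1)) := by push_cast; ring
    rw [ecast] at hup
    exact hup

end Summit.QuantumFields.YangMills.Cruxes.FibreAnchor.TraceVDR

end
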